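import Mathlib.Analysis.SpecialFunctions.Log.Base
import Mathlib.Analysis.Complex.ExponentialBounds
import Literature.Computability.AlgebraicComplexity.BorderRankCW
import Literature.Computability.AlgebraicComplexity.BorderRankCWDischarge
import Literature.Computability.AlgebraicComplexity.BorderRankKronecker
import Literature.Computability.AlgebraicComplexity.CoppersmithWinograd1990
import Literature.Computability.AlgebraicComplexity.CoppersmithWinograd1990Proofs
import HarnessLib

/-!
# The Coppersmith–Winograd "easy" bound `ω < 2.41` — proved unconditionally

Topic `Literature/Computability/AlgebraicComplexity`.  Part of the bottom layer of the decomposition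
of the named fact `vxxz2024_omega_le` (`RectangularExponent.lean`, Vassilevska Williams–Xu–Xu–Zhou
2024, whose §3.6 input is "`R̃(CW_q) ≤ q + 2` [CW90]"), and the first unconditional numerical upper
bound on the exponent of matrix multiplication in the tree.  Everything here is PROVED; no
definitions, no named facts.  The three ingredients, all already proved in the tree, are glued:

* `bR(T_cw,q) ≤ q + 2` for the little Coppersmith–Winograd tensor — `R_3(T_cw,q) ≤ q + 2`,
  `BorderRankCWDischarge.approxRank_three_cwTensor_le` (Coppersmith–Winograd's `q + 2` products,
  BCS §15.7, display before Cor. (15.43));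
* border rank bounds the growth of the ranks of Kronecker powers —
  `BorderRankKronecker.isBigO_tensorRank_kroneckerPow_of_approxRank_le` (Bläser 2013, Thm. 6.3(3),
  Lemma 6.4; BCS Lemma (15.27)), giving `isBigO_tensorRank_kroneckerPow_cwTensor`:
  `R(T_cw,q^{⊗N}) = O((q+2)^{(1+ε)N})` for every `ε > 0`, i.e. the hypothesis "`R̃(T_cw,q) ≤ q + 2`"
  of `CoppersmithWinograd1990_asymptoticRank_form`;
* the laser-method theorem `CoppersmithWinograd1990_asymptoticRank_form_holds`
  (`CoppersmithWinograd1990Proofs.lean`: Salem–Spencer diagonal, hashing, asymptotic sum inequality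
  in rank form): `R̃(T_cw,q) ≤ ρ ⇒ ω(ℂ) ≤ log_q(4ρ³/27)`.

## Main results

* `omega_le_logb_cw_easy` — **`ω(ℂ) ≤ log_q(4(q+2)³/27)` for every `q ≥ 2`** (BCS §15.7, proof of
  Cor. (15.43): "hence `ω ≤ log_q(4(q+2)³/27)`"; Coppersmith–Winograd 1990, §6).
* `BCS1997_cor1543` — **BCS Corollary (15.43) (Coppersmith and Winograd, 1987): `ω < 2.41`**
  ("Setting `q = 8`": `log₈(4000/27) = 2.4036…`; numerics: `8^{2.41} = 2⁷·2^{0.23}`, `e^x ≥ 1 + x`,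
  `log 2 > 0.6931471803`); `omega_le_logb_eight : ω(ℂ) ≤ log₈(4000/27)`.

## References

* P. Bürgisser, M. Clausen, M. A. Shokrollahi, *Algebraic Complexity Theory* (1997), §15.7: the
  display preceding Cor. (15.43) and Cor. (15.43); Lemma (15.27). [BurgisserClausenShokrollahi1997]
* D. Coppersmith, S. Winograd, *Matrix multiplication via arithmetic progressions*, J. Symbolic
  Comput. 9 (1990) 251–280, §6. [CoppersmithWinograd1990]
* V. Vassilevska Williams, Y. Xu, Z. Xu, R. Zhou, SODA 2024, arXiv:2307.07970, §3.6.
  [VassilevskaWilliamsXuXuZhou2024]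
-/

noncomputable section

open scoped BigOperators
open Filter Asymptotics

namespace Literature.Computability.AlgebraicComplexity

universe u

/-! ## Growth of the Kronecker powers of `T_cw,q` -/

section Growth

variable (K : Type u) [CommRing K]

/-- **Growth of the Kronecker powers of `T_cw,q`**: `R(T_cw,q^{⊗N}) = O((q+2)^{(1+ε)N})` for every
`ε > 0` (border rank `≤ q + 2` and BCS Lemma (15.27)); this is the hypothesis "`R̃(T_cw,q) ≤ q + 2`" of
`CoppersmithWinograd1990_asymptoticRank_form`. [cite: BurgisserClausenShokrollahi1997, Lemma (15.27)] -/
theorem isBigO_tensorRank_kroneckerPow_cwTensor (q : ℕ) {ε : ℝ} (hε : 0 < ε) :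
    (fun N : ℕ => (tensorRank (kroneckerPow (cwTensor K q) N) : ℝ)) =O[atTop]
      fun N : ℕ => ((q + 2 : ℕ) : ℝ) ^ ((1 + ε) * N) := by
  classical
  exact isBigO_tensorRank_kroneckerPow_of_approxRank_le (approxRank_three_cwTensor_le K q)
    (by omega) hε

end Growth

/-! ## The "easy" Coppersmith–Winograd bound -/

section Omega

/-- **`ω(ℂ) ≤ log_q(4(q+2)³/27)` for every `q ≥ 2`** (BCS §15.7, proof of Cor. (15.43): "hence
`ω ≤ log_q(4(q+2)³/27)`"; Coppersmith–Winograd 1990, §6), from the laser-method theorem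
`CoppersmithWinograd1990_asymptoticRank_form_holds` and `bR(T_cw,q) ≤ q + 2`.
[cite: BurgisserClausenShokrollahi1997, Cor. (15.43) (proof)] -/
theorem omega_le_logb_cw_easy (q : ℕ) (hq : 2 ≤ q) :
    omega ℂ ≤ Real.logb q (4 * ((q : ℝ) + 2) ^ 3 / 27) := by
  have h := CoppersmithWinograd1990_asymptoticRank_form_holds q hq ((q + 2 : ℕ) : ℝ)
    (by positivity) (fun ε hε => isBigO_tensorRank_kroneckerPow_cwTensor ℂ q hε)
  push_cast at h
  exact h

/-- `4000/27 < 8^{2.41}`: `8^{2.41} = 2⁷ · 2^{0.23} = 128 e^{0.23 log 2} ≥ 128 (1 + 0.23 log 2)` and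
`log 2 > 0.6931471803`. [folklore] -/
theorem cw_easy_numerics : (4 : ℝ) * ((8 : ℝ) + 2) ^ 3 / 27 < (8 : ℝ) ^ (2.41 : ℝ) := by
  have hlog2 := Real.log_two_gt_d9
  have h8 : (8 : ℝ) ^ (2.41 : ℝ) = (2 : ℝ) ^ (7 : ℕ) * Real.exp (Real.log 2 * 0.23) := by
    rw [show (8 : ℝ) = (2 : ℝ) ^ (3 : ℕ) by norm_num, ← Real.rpow_natCast (2 : ℝ) 3,
      ← Real.rpow_mul (by norm_num : (0 : ℝ) ≤ 2), ← Real.rpow_def_of_pos (by norm_num : (0 : ℝ) < 2),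
      ← Real.rpow_natCast (2 : ℝ) 7, ← Real.rpow_add (by norm_num : (0 : ℝ) < 2)]
    norm_num
  have hexp : Real.log 2 * 0.23 + 1 ≤ Real.exp (Real.log 2 * 0.23) := Real.add_one_le_exp _
  rw [h8]
  have h128 : (2 : ℝ) ^ (7 : ℕ) = 128 := by norm_num
  rw [h128]
  nlinarith

/-- **BCS Corollary (15.43) (Coppersmith and Winograd, 1987): `ω < 2.41`** ("Setting `q = 8`":
`log₈(4 · 10³/27) = 2.4036…`), over `ℂ`. The first unconditional numerical upper bound on `ω` in the
tree; all ingredients (laser method with a Salem–Spencer diagonal, asymptotic sum inequality in rank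
form, border rank `→` Kronecker-power ranks, `bR(T_cw,8) ≤ 10`) are proved.
[cite: BurgisserClausenShokrollahi1997, Cor. (15.43)] -/
theorem BCS1997_cor1543 : omega ℂ < 2.41 := by
  have h := omega_le_logb_cw_easy 8 (by norm_num)
  have hpos : (0 : ℝ) < 4 * ((8 : ℕ) + 2 : ℝ) ^ 3 / 27 := by positivity
  have hlt : Real.logb (8 : ℕ) (4 * (((8 : ℕ) : ℝ) + 2) ^ 3 / 27) < 2.41 := by
    rw [Real.logb_lt_iff_lt_rpow (by norm_num) hpos]
    exact_mod_cast cw_easy_numerics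
  exact h.trans_lt hlt

/-- The same bound as a non-strict inequality with the sharper constant read off the formula,
`ω(ℂ) ≤ log₈(4000/27)`. [cite: BurgisserClausenShokrollahi1997, Cor. (15.43) (proof)] -/
theorem omega_le_logb_eight : omega ℂ ≤ Real.logb 8 (4000 / 27) := by
  have h := omega_le_logb_cw_easy 8 (by norm_num)
  norm_num at h
  exact h

end Omega

end Literature.Computability.AlgebraicComplexity

end
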